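import Literature.NumberTheory.EllipticCurves.BigGaloisRepSelmer
import Summits.BirchSwinnertonDyer.Rank1Residual.X11b.SelmerTorsionControl
import Summits.BirchSwinnertonDyer.Rank1Residual.X11b.PontryaginCongruence
import Summits.BirchSwinnertonDyer.BirchSwinnertonDyer.Theorems.ErratumRoadFiveSelmerTorsionControlFinite
import Summits.BirchSwinnertonDyer.BirchSwinnertonDyer.Theorems.ErratumRoadFiveTwoVariableControlDualFinite
import Literature.Algebra.Module.CharacterModuleAnnihilator
import Mathlib.RingTheory.Ideal.Quotient.Basic
import Mathlib.RingTheory.Filtration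
import Mathlib.LinearAlgebra.Isomorphisms
import Mathlib.GroupTheory.QuotientGroup.Finite
import HarnessLib

/-!
# Crux `BSDpOnCellC` (stmt-BirchSwinnertonDyer-19034), stub `stub_carrierAlg` (K2) — idea `k2-classical`:
# the CLASSICAL two-variable witness `X₂ := XBig κ ρ₂ 𝔭̄ ∅` over `Λ₂ = 𝒪₂⟦T⟧`, `𝒪₂ = R₀⟦X′⟧`,
# and its weight-variable control — SIX theorems, 0 sorries: exact control (§1), Artin–Rees
# finiteness transfer (§2), global defect (§3), two-sided finite control Selmer side (§4) and dual side (§5),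
# finite generation two-sided (§6).

Ideator `bsd-idea-12` g30 (planner; publish-only W-79: this file is a SKETCH for the crux idea card
`Cruxes/BSDpOnCellC/Ideas/k2-classical.md`; it registers nothing and touches no skeleton).

* §1 `quotXBig_equiv_dual_selmer_torsion` — PROVED: for ANY coefficient ring `𝒪₂`, any discrete
  `𝒪₂`-linear `ρ₂` on `A₂`, any `r ∈ Λ₂ = PowerSeries 𝒪₂` acting surjectively on `M = A₂ ⊗ Λ^*`, with
  `r`-divisible global and constrained-local invariants: `X₂ ⧸ r X₂ ≃ₗ[Λ₂] Sel(M[r])^∨` where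
  `X₂ = XBig κ ρ₂ 𝔮 Σ`. This is the tree's erratum-Lemma-2.1 control (`TorsionControl.selmerTorsionEquiv`)
  composed with the tree's Pontryagin step (`PontryaginCongruence.nonempty_quotSMulTop_equiv_dual_torsionBy`),
  read at the WEIGHT specialisation `r = π_k := X′ − x_k` (a constant of `Λ₂ = 𝒪₂⟦T⟧`) instead of `ϖ^m` / `T_c`.
* §3 `finite_ker_torsionInclH1_of_finite_quot` — PROVED: the GLOBAL control defect `ker H¹(ι_r) = δ₀(M^Γ)` is
  finite as soon as `M^Γ ⧸ r·M^Γ` is (replaces the template's (glob), false on cell C).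
* §4 `twoSided_finite_control` — PROVED: Selmer-side control with FINITE KERNEL (§3) AND FINITE COKERNEL (tree
  `SelmerFiniteDefect.finite_selmer_torsion_quot`) — neither (glob) nor (dec) assumed; the cell-C replacement of
  erratum Lemma 2.1.
* §5 `exists_quotSMulTop_linearMap_twoSided` — PROVED: the Pontryagin-DUAL form: from an additive `C`-semilinear
  `θ : N₁ → N₂`, `r θ = 0`, with FINITE kernel and finite-index range in `N₂[r]`, an `R`-linear
  `f : N₂^∨ ⧸ r → N₁^∨`, `f[χ] = χ ∘ θ`, with FINITE KERNEL AND FINITE COKERNEL (the tree's injective case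
  `ControlDualFinite.exists_quotSMulTop_linearMap_of_finite_index` applied to `N₁ ⧸ ker θ`, plus `(ker θ)^∨` finite) —
  i.e. `X₂ ⧸ (X′ − x_k) X₂ → X(M₂[X′ − x_k])` with finite kernel and cokernel, which is all (alg_k) needs.
* §6 `module_finite_characterModule_twoSided` — PROVED: `N₂^∨` finitely generated over the `(r)`-complete `S` from
  `N₁^∨` finitely generated over Noetherian `R` and finite-index range, NO injectivity (C3, f.g. part).
* §2 `finite_torsionBy_of_finite_quot` — PROVED: the first NEW lemma of the classical line (pure commutative
  algebra): over a Noetherian ring, a finitely generated module with finite `r`-cotorsion has finite `r`-torsion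
  (Artin–Rees). It converts "member-level local invariants over the local
  anticyclotomic tower are finite for every member" (`C ⧸ π_k C` finite) into "the control defect at `𝔭̄` is
  finite for every member" (`C[π_k]` finite), `C = (H⁰(K_𝔭̄, M₂))^∨`.

HONEST FRAMING: nothing about any curve, newform or `L`-function is asserted; BSD is proved for no pair;
the branch lattice `ρ₂` is a binder, not constructed.
-/

noncomputable section

-- D-0017: single-problem summit, the namespace repeats the problem name by design.
set_option linter.dupNamespace false

open CategoryTheory Field IsDedekindDomain NumberField
open Literature.NumberTheory.GaloisRepresentations Literature.NumberTheory.EllipticCurves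
open Literature.NumberTheory.EllipticCurves.BigGaloisRep
open Summit.BirchSwinnertonDyer.Rank1Residual.X11b
open scoped ContRepresentation Pointwise

universe u

namespace Summit.BirchSwinnertonDyer.BirchSwinnertonDyer.Cruxes.BSDpOnCellC.ClassicalWitness

/-! ## §1 Exact weight-variable control in Pontryagin-dual form (PROVED, tree lemmas only) -/

section Control

variable {K : Type u} [Field K] [NumberField K] {p : ℕ} [Fact p.Prime]
  {𝒪₂ : Type*} [CommRing 𝒪₂] [TopologicalSpace 𝒪₂]
  {A₂ : Type u} [AddCommGroup A₂] [Module 𝒪₂ A₂] [TopologicalSpace A₂] [DiscreteTopology A₂]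
  [TopologicalSpace (PowerSeries 𝒪₂)] [ContinuousSMul (PowerSeries 𝒪₂) (BigRepModule 𝒪₂ p A₂)]

/-- **`X₂ ⧸ r·X₂ ≃ Sel(M₂[r])^∨`** for `X₂ = XBig κ ρ₂ 𝔮 Σ = Sel^Σ_𝔮(K, M₂)^∨`, `M₂ = A₂ ⊗ Λ^*(Ψ⁻¹)`
(`AnticyclotomicBigGaloisRep κ ρ₂`), and ANY `r ∈ Λ₂ = 𝒪₂⟦T⟧` acting surjectively on `M₂` whose global
invariants `M₂^{Γ_K}` and constrained local invariants `M₂^{Γ_v}` (`v ∈ strictSet p 𝔮 Σ`) are `r`-divisible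
(the EXACT case: no control defect). Intended reading: `𝒪₂ = R₀⟦X′⟧` the disc chart of the Hida branch through
`f_E`, `ρ₂` the self-dual branch lattice `𝐓† ⊗ 𝒪₂^∨`, `r = C(X′ − x_k)` the weight-`k` specialisation, so that
`M₂[r]` is the member's big representation and the right-hand side is the member's `X`.
[cite: Castella2018Erratum, Lemma 2.1 (p. 2)] [cite: JetchevSkinnerWan2017, Lemma 3.4.1 (arXiv:1512.06894 p. 14)]
[cite: Delbourgo2008, App. C (P. Smith), Thm. C.15 (p. 362 of the CUP PDF; weight-variable control)] -/
theorem quotXBig_equiv_dual_selmer_torsion (κ : ZpExtension K p)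
    (ρ₂ : ContinuousRep (absoluteGaloisGroup K) 𝒪₂ A₂)
    (𝔮 : HeightOneSpectrum (𝓞 K)) (S : Set (HeightOneSpectrum (𝓞 K))) (r : PowerSeries 𝒪₂)
    (hr : Function.Surjective fun m : BigRepModule 𝒪₂ p A₂ => r • m)
    (hglob : ∀ w ∈ (AnticyclotomicBigGaloisRep κ ρ₂).toTopRep.ρ.invariants,
      ∃ w' ∈ (AnticyclotomicBigGaloisRep κ ρ₂).toTopRep.ρ.invariants, r • w' = w)
    (hloc : ∀ v ∈ strictSet p 𝔮 S,
      ∀ w ∈ (((AnticyclotomicBigGaloisRep κ ρ₂).restrict (localMap K v)).toTopRep).ρ.invariants,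
        ∃ w' ∈ (((AnticyclotomicBigGaloisRep κ ρ₂).restrict (localMap K v)).toTopRep).ρ.invariants,
          r • w' = w) :
    Nonempty ((XBig κ ρ₂ 𝔮 S ⧸ r • (⊤ : Submodule (PowerSeries 𝒪₂) (XBig κ ρ₂ 𝔮 S))) ≃ₗ[PowerSeries 𝒪₂]
      CharacterModule (TorsionControl.selmer (localMap K) (strictSet p 𝔮 S)
        (TorsionControl.torsionRep (AnticyclotomicBigGaloisRep κ ρ₂) r))) := by
  obtain ⟨e₁⟩ := PontryaginCongruence.nonempty_quotSMulTop_equiv_dual_torsionBy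
    (R := PowerSeries 𝒪₂) (S := selmerBig κ ρ₂ 𝔮 S) r
  let e₂ := TorsionControl.selmerTorsionEquiv (localMap K) (strictSet p 𝔮 S)
    (AnticyclotomicBigGaloisRep κ ρ₂) r hr hglob hloc
  exact ⟨e₁.trans (CharacterModule.congr e₂).symm⟩

end Control

/-! ## §2 The first NEW lemma of the classical line: finite cotorsion ⇒ finite torsion (PROVED, Artin–Rees) -/

/-- **Finite `r`-cotorsion ⇒ finite `r`-torsion (PROVED).** For a finitely generated module `C` over a Noetherian
ring `R`: if `C ⧸ r·C` is finite then so is `C[r]`. Proof: Artin–Rees (`Ideal.exists_pow_inf_eq_pow_smul`) gives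
`C[r] ∩ r^{k+1}C = r·(C[r] ∩ r^k C) ⊆ r·C[r] = 0`, so `C[r] ↪ C ⧸ r^{k+1}C`, which is finite because
`C ⧸ r^{n+1}C` is an extension of `C ⧸ rⁿC` by a quotient of `C ⧸ rC` (induction on `n`). In the classical line
`R = 𝒪₂ = R₀⟦X′⟧`, `C = (M₂^{Γ_{K_𝔭̄}})^∨` (finitely generated over `R₀⟦X′⟧` because the tame character `ω` kills the
`𝐓⁺`-dual piece and the inertia relation `δ = (1+X′)^a (1+T)^b − 1` is `T`-distinguished on the `𝐓⁻`-dual piece) or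
`C = (M₂^{Γ_K})^∨`, `r = X′ − x_k`, and `C ⧸ rC` = the dual of the member's invariants (local anticyclotomic tower at 𝔭̄,
resp. global), finite for EVERY member (`k = 2`: Tate curve / `E(K^{ac}_∞)[p^∞]`; `k > 2`: Hodge–Tate weights); the
conclusion `C[r]` finite is the finiteness of the local control defect `M₂^{Γ_{K_𝔭̄}} ⧸ π_k` (input (fin) of the tree's
`ErratumThm23TwoVariable.ControlFiniteDefect.exists_controlMap_of_finite_defect` / `finite_selmer_torsion_quot`), resp.
of the global defect `δ₀(M₂^{Γ_K})` (`TorsionControl.cohomologyMap_torsionIncl_eq_zero_iff`). Pure Mathlib. [folklore] -/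
theorem finite_torsionBy_of_finite_quot {R : Type*} [CommRing R] [IsNoetherianRing R]
    {C : Type*} [AddCommGroup C] [Module R C] [Module.Finite R C]
    (r : R) (hfin : Finite (C ⧸ r • (⊤ : Submodule R C))) :
    Finite (Submodule.torsionBy R C r) := by
  classical
  set I : Ideal R := Ideal.span {r} with hI
  set N : Submodule R C := Submodule.torsionBy R C r with hN
  have hIpow : ∀ n : ℕ, I ^ n • (⊤ : Submodule R C) = (r ^ n) • (⊤ : Submodule R C) := fun n => by
    rw [hI, Ideal.span_singleton_pow, Submodule.ideal_span_singleton_smul]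
  -- all the quotients `C ⧸ rⁿ C` are finite
  have hq : ∀ n : ℕ, Finite (C ⧸ (r ^ n) • (⊤ : Submodule R C)) := by
    intro n
    induction n with
    | zero =>
        refine Finite.of_surjective (fun _ : Unit => (0 : C ⧸ (r ^ 0) • (⊤ : Submodule R C))) ?_
        intro x
        induction x using Submodule.Quotient.induction_on with
        | H c =>
          refine ⟨(), ?_⟩
          simp only
          symm
          rw [Submodule.Quotient.mk_eq_zero, pow_zero, one_smul]
          exact Submodule.mem_top
    | succ n ih =>
        set Q : Submodule R C := (r ^ (n + 1)) • (⊤ : Submodule R C) with hQ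
        set Q' : Submodule R C := (r ^ n) • (⊤ : Submodule R C) with hQ'
        have hle : Q ≤ Q' := by
          rintro x hx
          obtain ⟨c, -, rfl⟩ := (Submodule.mem_smul_pointwise_iff_exists _ _ _).mp hx
          refine (Submodule.mem_smul_pointwise_iff_exists _ _ _).mpr ⟨r • c, Submodule.mem_top, ?_⟩
          rw [pow_succ, mul_smul]
        set P : Submodule R (C ⧸ Q) := Q'.map Q.mkQ with hP
        have e := Submodule.quotientQuotientEquivQuotient Q Q' hle
        haveI hfinQP : Finite ((C ⧸ Q) ⧸ P) := Finite.of_equiv _ e.toEquiv.symm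
        -- `P` is the image of `c ↦ rⁿ c`, which factors through the finite `C ⧸ r C`
        let g : C →ₗ[R] C ⧸ Q := (r ^ n) • Q.mkQ
        have hg : ∀ c : C, g c = Q.mkQ ((r ^ n) • c) := fun c => by
          simp only [g, LinearMap.smul_apply, map_smul]
        have hker : r • (⊤ : Submodule R C) ≤ LinearMap.ker g := by
          rintro x hx
          obtain ⟨c, -, rfl⟩ := (Submodule.mem_smul_pointwise_iff_exists _ _ _).mp hx
          rw [LinearMap.mem_ker, hg, Submodule.mkQ_apply, Submodule.Quotient.mk_eq_zero]
          refine (Submodule.mem_smul_pointwise_iff_exists _ _ _).mpr ⟨c, Submodule.mem_top, ?_⟩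
          rw [pow_succ, mul_smul]
        let gbar : (C ⧸ r • (⊤ : Submodule R C)) →ₗ[R] C ⧸ Q := (r • (⊤ : Submodule R C)).liftQ g hker
        have hPle : P ≤ LinearMap.range gbar := by
          rintro x hx
          obtain ⟨c, hc, rfl⟩ := Submodule.mem_map.mp hx
          obtain ⟨c', -, rfl⟩ := (Submodule.mem_smul_pointwise_iff_exists _ _ _).mp hc
          refine ⟨Submodule.Quotient.mk c', ?_⟩
          exact (Submodule.liftQ_apply _ _ c').trans (hg c')
        haveI : Finite (LinearMap.range gbar) := by
          have : Finite (Set.range gbar) := Set.finite_range gbar |>.to_subtype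
          exact this
        haveI hfinP : Finite P := Finite.of_injective (Submodule.inclusion hPle) (Submodule.inclusion_injective hPle)
        haveI : Finite P.toAddSubgroup := hfinP
        haveI : Finite ((C ⧸ Q) ⧸ P.toAddSubgroup) := hfinQP
        exact Finite.of_addSubgroup_quotient P.toAddSubgroup
  -- Artin–Rees: `N ∩ r^{k+1} C = 0`
  obtain ⟨k, hk⟩ := Ideal.exists_pow_inf_eq_pow_smul I N
  have hbot : I ^ (k + 1) • (⊤ : Submodule R C) ⊓ N = ⊥ := by
    rw [hk (k + 1) (by omega), show k + 1 - k = 1 from by omega, pow_one]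
    refine eq_bot_iff.mpr ?_
    calc I • (I ^ k • ⊤ ⊓ N) ≤ I • N := Submodule.smul_mono le_rfl inf_le_right
      _ = r • N := by rw [hI, Submodule.ideal_span_singleton_smul]
      _ ≤ ⊥ := by
          rintro x hx
          obtain ⟨m, hm, rfl⟩ := (Submodule.mem_smul_pointwise_iff_exists _ _ _).mp hx
          rw [hN, Submodule.mem_torsionBy_iff] at hm
          simpa using hm
  -- `N ↪ C ⧸ r^{k+1} C`
  haveI := hq (k + 1)
  refine Finite.of_injective (fun x : N => ((r ^ (k + 1)) • (⊤ : Submodule R C)).mkQ (x : C)) ?_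
  intro x y hxy
  have hmem : (x : C) - y ∈ (r ^ (k + 1)) • (⊤ : Submodule R C) := by
    simpa [Submodule.mkQ_apply] using (Submodule.Quotient.eq _).mp hxy
  have hmemN : (x : C) - y ∈ N := N.sub_mem x.2 y.2
  have : (x : C) - y ∈ I ^ (k + 1) • (⊤ : Submodule R C) ⊓ N := ⟨by rw [hIpow]; exact hmem, hmemN⟩
  rw [hbot, Submodule.mem_bot, sub_eq_zero] at this
  exact Subtype.ext this

/-! ## §3 The GLOBAL control defect is finite: `ker H¹(ι_r) = δ₀(M^Γ)` is a quotient of `M^Γ ⧸ r·M^Γ` (PROVED) -/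

section GlobalDefect

variable {A : Type*} [CommRing A] [TopologicalSpace A]
variable {Γ : Type u} [Group Γ] [TopologicalSpace Γ] [IsTopologicalGroup Γ]
variable {M : Type u} [AddCommGroup M] [Module A M] [TopologicalSpace M] [DiscreteTopology M]
  [ContinuousSMul A M]

/-- **Finite global defect.** For an `r`-divisible discrete `Γ`-module `M` over `A`: if `M^Γ ⧸ r·M^Γ` is finite
then `ker (H¹(ι) : H¹(Γ, M[r]) → H¹(Γ, M))` is finite — it equals `δ₀(M^Γ)` (tree
`TorsionControl.cohomologyMap_torsionIncl_eq_zero_iff`) and `δ₀` kills `r·M^Γ` (tree `IsSES.δ₀_eq_zero_iff`; the LOCAL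
twin of this step is the tree's `SelmerFiniteDefect.smul_top_le_ker_δ₀` / `finite_range_δ₀`, whose argument is reused). This
replaces the template's hypothesis (glob) «`M^{Γ_K}` has no `p`-torsion» (FALSE on cell C: rational `p`-torsion) by
«the global defect is finite for every member»; combined with §2 its input is the finiteness of the member's global
invariants (`E(K^{ac}_∞)[p^∞]` finite at `k = 2`). [cite: Castella2018Erratum, Lemma 2.1 (proof)] [folklore] -/
theorem finite_ker_torsionInclH1_of_finite_quot (ρ : ContinuousRep Γ A M) (r : A)
    (hr : Function.Surjective fun m : M => r • m)
    (hfin : Finite (↥ρ.toTopRep.ρ.invariants ⧸ r • (⊤ : Submodule A ↥ρ.toTopRep.ρ.invariants))) :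
    Finite (LinearMap.ker (TorsionControl.torsionInclH1 ρ r)) := by
  have hSES := TorsionControl.isSES_torsion ρ r hr
  have hker : r • (⊤ : Submodule A ↥ρ.toTopRep.ρ.invariants) ≤ LinearMap.ker hSES.δ₀ := by
    rintro x hx
    obtain ⟨w, -, rfl⟩ := (Submodule.mem_smul_pointwise_iff_exists _ _ _).mp hx
    rw [LinearMap.mem_ker, hSES.δ₀_eq_zero_iff]
    exact ⟨w.1, w.2, rfl⟩
  let δbar := (r • (⊤ : Submodule A ↥ρ.toTopRep.ρ.invariants)).liftQ hSES.δ₀ hker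
  haveI : Finite (LinearMap.range δbar) := (Set.finite_range δbar).to_subtype
  have hrange : LinearMap.range hSES.δ₀ = LinearMap.range δbar := (Submodule.range_liftQ _ _ _).symm
  have hkr : LinearMap.ker (TorsionControl.torsionInclH1 ρ r) ≤ LinearMap.range δbar := by
    intro x hx
    rw [LinearMap.mem_ker, TorsionControl.torsionInclH1_apply] at hx
    obtain ⟨v, hv⟩ := (TorsionControl.cohomologyMap_torsionIncl_eq_zero_iff ρ r hr x).1 hx
    rw [← hrange]
    exact ⟨v, hv⟩
  exact Finite.of_injective (Submodule.inclusion hkr) (Submodule.inclusion_injective hkr)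

end GlobalDefect

/-! ## §4 Two-sided finite control, Selmer side (PROVED: §3 + the tree's `finite_selmer_torsion_quot`) -/

section TwoSided

variable {A : Type*} [CommRing A] [TopologicalSpace A]
variable {Γ : Type u} [Group Γ] [TopologicalSpace Γ] [IsTopologicalGroup Γ]
variable {M : Type u} [AddCommGroup M] [Module A M] [TopologicalSpace M] [DiscreteTopology M]
  [ContinuousSMul A M]
variable {ι : Type*} {Γv : ι → Type u} [∀ v, Group (Γv v)] [∀ v, TopologicalSpace (Γv v)]
  [∀ v, IsTopologicalGroup (Γv v)] (φ : ∀ v, Γv v →ₜ* Γ) (L : Set ι)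

/-- **Two-sided finite control (Selmer side), the cell-C replacement of erratum Lemma 2.1 / [JSW17, L. 3.4.1].**
For `r`-divisible `M`: if the GLOBAL invariants have finite `r`-cotorsion (`M^Γ ⧸ r`), the constrained local invariants
have finite `r`-cotorsion at the finitely many `v ∈ L₀` and are `r`-divisible at the other constrained `v`, then the
control map `θ_r : Sel(M[r]) → Sel(M)[r]` (restriction of `H¹(ι)`) has FINITE KERNEL (§3) and FINITE COKERNEL (tree
`SelmerFiniteDefect.finite_selmer_torsion_quot`, no global hypothesis). Neither (glob) nor (dec) of the exact case is
assumed — both fail on cell C. Intended instance: `Γ = Γ_K`, `M = M₂` the two-variable module over `Λ₂ = 𝒪₂⟦T⟧`,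
`r = X′ − x_k`, `L₀ = {𝔭̄}` (decomposition index), the inertia indices divisible (Steinberg monodromy / unramified).
[cite: JetchevSkinnerWan2017, Lemma 3.4.1 (arXiv:1512.06894 p. 14)] [cite: Castella2018Erratum, Lemma 2.1 (p. 2)] -/
theorem twoSided_finite_control (ρ : ContinuousRep Γ A M) (r : A)
    (hr : Function.Surjective fun m : M => r • m)
    (hglob : Finite (↥ρ.toTopRep.ρ.invariants ⧸ r • (⊤ : Submodule A ↥ρ.toTopRep.ρ.invariants)))
    (L₀ : Finset ι) (hL₀ : ∀ v ∈ L₀, v ∈ L)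
    (hloc : ∀ v ∈ L, v ∉ L₀ → ∀ w ∈ ((ρ.restrict (φ v)).toTopRep).ρ.invariants,
      ∃ w' ∈ ((ρ.restrict (φ v)).toTopRep).ρ.invariants, r • w' = w)
    (hfin : ∀ v ∈ L₀, Finite (QuotSMulTop r ↥(((ρ.restrict (φ v)).toTopRep).ρ.invariants))) :
    Finite ↥(LinearMap.ker ((TorsionControl.torsionInclH1 ρ r).domRestrict
        (TorsionControl.selmer φ L (TorsionControl.torsionRep ρ r)))) ∧
    Finite (↥(TorsionControl.selmer φ L ρ ⊓ Submodule.torsionBy A (continuousCohomology 1 ρ.toTopRep) r) ⧸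
      Submodule.comap (TorsionControl.selmer φ L ρ ⊓
          Submodule.torsionBy A (continuousCohomology 1 ρ.toTopRep) r).subtype
        (Submodule.map (TorsionControl.torsionInclH1 ρ r)
          (TorsionControl.selmer φ L (TorsionControl.torsionRep ρ r)))) := by
  refine ⟨?_, Theorems.ErratumThm23TwoVariable.SelmerFiniteDefect.finite_selmer_torsion_quot φ L ρ r hr L₀ hL₀
    hloc hfin⟩
  haveI := finite_ker_torsionInclH1_of_finite_quot ρ r hr hglob
  refine Finite.of_injective
    (fun x : LinearMap.ker ((TorsionControl.torsionInclH1 ρ r).domRestrict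
        (TorsionControl.selmer φ L (TorsionControl.torsionRep ρ r))) =>
      (⟨(x.1 : continuousCohomology 1 (TorsionControl.torsionRep ρ r).toTopRep), by
        have hx := x.2
        rw [LinearMap.mem_ker, LinearMap.domRestrict_apply] at hx
        exact hx⟩ : LinearMap.ker (TorsionControl.torsionInclH1 ρ r))) ?_
  intro x y hxy
  apply Subtype.ext
  apply Subtype.ext
  simpa using congrArg Subtype.val hxy

end TwoSided

/-! ## §5 Two-sided finite control, Pontryagin-dual side (PROVED: the tree's injective case + the kernel quotient) -/

section Dual

/-- **Pontryagin dual of a two-sided finite control map.** For an additive `C`-semilinear `θ : N₁ → N₂` with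
`r • θ = 0`, FINITE KERNEL and range of FINITE INDEX in `N₂[r]`, there is an `R`-linear
`f : N₂^∨ ⧸ r·N₂^∨ → N₁^∨` with `f [χ] = χ ∘ θ`, FINITE KERNEL and FINITE COKERNEL. (Apply the tree's injective case
`ControlDualFinite.exists_quotSMulTop_linearMap_of_finite_index` to `θ̄ : N₁ ⧸ ker θ ↪ N₂` and compose with the injective
dual of `N₁ ↠ N₁ ⧸ ker θ`, whose cokernel embeds in `(ker θ)^∨`, finite.) The dual form of §4: `X₂ ⧸ r X₂ → X(M₂[r])` has
finite kernel and cokernel. [cite: JetchevSkinnerWan2017, §3.4, Lemma 3.4.1 (arXiv:1512.06894 p. 14)] [folklore] -/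
theorem exists_quotSMulTop_linearMap_twoSided {R S : Type} [CommRing R] [CommRing S] (C : R →+* S) (r : S)
    {N₁ N₂ : Type} [AddCommGroup N₁] [Module R N₁] [AddCommGroup N₂] [Module S N₂] (θ : N₁ →+ N₂)
    (hθC : ∀ (a : R) (n : N₁), θ (a • n) = C a • θ n) (hθr : ∀ n : N₁, r • θ n = 0)
    (hker : Finite θ.ker)
    (hfin : Finite (↥(Submodule.torsionBy S N₂ r).toAddSubgroup ⧸
      (θ.range).addSubgroupOf (Submodule.torsionBy S N₂ r).toAddSubgroup)) :
    ∃ f : (letI : Module R (QuotSMulTop r (CharacterModule N₂)) := Module.compHom _ C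
          QuotSMulTop r (CharacterModule N₂) →ₗ[R] CharacterModule N₁),
      (∀ χ : CharacterModule N₂, f (Submodule.Quotient.mk χ) = χ.comp θ) ∧
      (letI : Module R (QuotSMulTop r (CharacterModule N₂)) := Module.compHom _ C
       Finite (LinearMap.ker f)) ∧
      (letI : Module R (QuotSMulTop r (CharacterModule N₂)) := Module.compHom _ C
       Finite (CharacterModule N₁ ⧸ LinearMap.range f)) := by
  classical
  letI : Module R (QuotSMulTop r (CharacterModule N₂)) := Module.compHom _ C
  -- the kernel as an `R`-submodule
  let K : Submodule R N₁ :=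
    { carrier := θ.ker
      add_mem' := fun ha hb => θ.ker.add_mem ha hb
      zero_mem' := θ.ker.zero_mem
      smul_mem' := fun a n hn => by
        change θ (a • n) = 0
        rw [hθC, show θ n = 0 from hn, smul_zero] }
  haveI hKfin : Finite K := Finite.of_equiv θ.ker (Equiv.subtypeEquivRight fun _ => Iff.rfl)
  -- `θ̄ : N₁ ⧸ K → N₂`
  let θbar : (N₁ ⧸ K) →+ N₂ := QuotientAddGroup.lift K.toAddSubgroup θ fun n hn => hn
  have hθbar : ∀ n : N₁, θbar (Submodule.Quotient.mk n) = θ n := fun _ => rfl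
  have hθbarC : ∀ (a : R) (q : N₁ ⧸ K), θbar (a • q) = C a • θbar q := by
    intro a q
    induction q using Submodule.Quotient.induction_on with
    | H n => rw [← Submodule.Quotient.mk_smul, hθbar, hθbar, hθC]
  have hθbarr : ∀ q : N₁ ⧸ K, r • θbar q = 0 := by
    intro q
    induction q using Submodule.Quotient.induction_on with
    | H n => rw [hθbar, hθr]
  have hinj : Function.Injective θbar := by
    intro q q' h
    induction q using Submodule.Quotient.induction_on with
    | H n =>
      induction q' using Submodule.Quotient.induction_on with
      | H n' =>
        rw [hθbar, hθbar] at h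
        refine (Submodule.Quotient.eq K).2 ?_
        change θ (n - n') = 0
        rw [map_sub, h, sub_self]
  have hrange : θbar.range = θ.range := by
    ext x
    constructor
    · rintro ⟨q, rfl⟩
      induction q using Submodule.Quotient.induction_on with
      | H n => exact ⟨n, (hθbar n).symm⟩
    · rintro ⟨n, rfl⟩
      exact ⟨Submodule.Quotient.mk n, hθbar n⟩
  have hfin' : Finite (↥(Submodule.torsionBy S N₂ r).toAddSubgroup ⧸
      (θbar.range).addSubgroupOf (Submodule.torsionBy S N₂ r).toAddSubgroup) := by
    rw [hrange]; exact hfin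
  obtain ⟨fbar, hsurj, hfbar, hkerfin⟩ :=
    Theorems.ErratumThm23TwoVariable.ControlDualFinite.exists_quotSMulTop_linearMap_of_finite_index
      C r θbar hθbarC hθbarr hinj hfin'
  -- compose with the (injective) dual of the projection
  let πd : CharacterModule (N₁ ⧸ K) →ₗ[R] CharacterModule N₁ := CharacterModule.dual K.mkQ
  have hπd : Function.Injective πd := CharacterModule.dual_injective_of_surjective _ (Submodule.mkQ_surjective K)
  refine ⟨πd ∘ₗ fbar, fun χ => ?_, ?_, ?_⟩
  · rw [LinearMap.comp_apply, hfbar]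
    rfl
  · rw [LinearMap.ker_comp_of_ker_eq_bot _ (LinearMap.ker_eq_bot.2 hπd)]
    exact hkerfin
  · -- the cokernel of `πd ∘ fbar` is that of `πd`, which embeds in `K^∨`
    rw [LinearMap.range_comp_of_range_eq_top _ (LinearMap.range_eq_top.2 hsurj)]
    let ρ : CharacterModule N₁ →ₗ[R] CharacterModule K := CharacterModule.dual K.subtype
    have hle : LinearMap.ker ρ ≤ LinearMap.range πd := by
      intro χ hχ
      have hχK : ∀ n ∈ K.toAddSubgroup, χ n = 0 := fun n hn => by
        have := DFunLike.congr_fun (LinearMap.mem_ker.1 hχ) ⟨n, hn⟩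
        exact this
      refine ⟨QuotientAddGroup.lift K.toAddSubgroup χ hχK, ?_⟩
      ext n
      rfl
    haveI : Finite (CharacterModule K) := (Literature.Algebra.Module.natCard_characterModule_le (M := K)).1
    haveI : Finite (LinearMap.range ρ) := inferInstance
    haveI : Finite (CharacterModule N₁ ⧸ LinearMap.ker ρ) :=
      Finite.of_equiv _ (LinearMap.quotKerEquivRange ρ).toEquiv.symm
    exact Finite.of_surjective (Submodule.factor hle) (Submodule.factor_surjective hle)

end Dual

/-! ## §6 Finite generation of `X₂` over `Λ₂` from that of the member, two-sided case (PROVED) -/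

section FiniteGeneration

/-- **`N₂^∨` is finitely generated over `S`** when `S` is `(r)`-adically (pre)complete, `N₂` is `r`-power torsion,
`N₁^∨` is finitely generated over a Noetherian `R`, and the additive `C`-semilinear `θ : N₁ → N₂` (`rθ = 0`) has
finite-index range in `N₂[r]` — with NO injectivity (the kernel may be anything: `(N₁ ⧸ ker θ)^∨ ↪ N₁^∨` is finitely
generated by Noetherianity); the tree's injective case `ControlDualFinite.module_finite_characterModule_of_finite_index`
applied to `θ̄ : N₁ ⧸ ker θ ↪ N₂`. In the classical line: `X₂ = XBig κ ρ₂ 𝔭̄ ∅` is finitely generated over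
`Λ₂ = 𝒪₂⟦T⟧` — indeed over `𝒪₂⟦T⟧` in the variable `X′ − x_k ∈ 𝒪₂`, `M₂` being `X′`-primary — as soon as ONE member's
`X` is (C3, f.g. part; cf. `ErratumThm23TwoVariable.ControlFiniteDefect.module_finite_XBig_iterate_of_finite_defect`).
[cite: JetchevSkinnerWan2017, §3.4 (arXiv:1512.06894 p. 14)] [cite: Matsumura1987, Theorem 8.4] -/
theorem module_finite_characterModule_twoSided {R S : Type*} [CommRing R] [CommRing S] [IsNoetherianRing R]
    (C : R →+* S) (r : S) [IsPrecomplete (Ideal.span {r}) S]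
    {N₁ N₂ : Type*} [AddCommGroup N₁] [Module R N₁] [AddCommGroup N₂] [Module S N₂] (θ : N₁ →+ N₂)
    (hθC : ∀ (a : R) (n : N₁), θ (a • n) = C a • θ n) (hθr : ∀ n : N₁, r • θ n = 0)
    (hfin : Finite (↥(Submodule.torsionBy S N₂ r).toAddSubgroup ⧸
      (θ.range).addSubgroupOf (Submodule.torsionBy S N₂ r).toAddSubgroup))
    (htors : ∀ y : N₂, ∃ n : ℕ, r ^ n • y = 0)
    [Module.Finite R (CharacterModule N₁)] :
    Module.Finite S (CharacterModule N₂) := by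
  classical
  let K : Submodule R N₁ :=
    { carrier := θ.ker
      add_mem' := fun ha hb => θ.ker.add_mem ha hb
      zero_mem' := θ.ker.zero_mem
      smul_mem' := fun a n hn => by
        change θ (a • n) = 0
        rw [hθC, show θ n = 0 from hn, smul_zero] }
  let θbar : (N₁ ⧸ K) →+ N₂ := QuotientAddGroup.lift K.toAddSubgroup θ fun n hn => hn
  have hθbar : ∀ n : N₁, θbar (Submodule.Quotient.mk n) = θ n := fun _ => rfl
  have hθbarC : ∀ (a : R) (q : N₁ ⧸ K), θbar (a • q) = C a • θbar q := by
    intro a q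
    induction q using Submodule.Quotient.induction_on with
    | H n => rw [← Submodule.Quotient.mk_smul, hθbar, hθbar, hθC]
  have hθbarr : ∀ q : N₁ ⧸ K, r • θbar q = 0 := by
    intro q
    induction q using Submodule.Quotient.induction_on with
    | H n => rw [hθbar, hθr]
  have hinj : Function.Injective θbar := by
    intro q q' h
    induction q using Submodule.Quotient.induction_on with
    | H n =>
      induction q' using Submodule.Quotient.induction_on with
      | H n' =>
        rw [hθbar, hθbar] at h
        refine (Submodule.Quotient.eq K).2 ?_
        change θ (n - n') = 0
        rw [map_sub, h, sub_self]
  have hrange : θbar.range = θ.range := by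
    ext x
    constructor
    · rintro ⟨q, rfl⟩
      induction q using Submodule.Quotient.induction_on with
      | H n => exact ⟨n, (hθbar n).symm⟩
    · rintro ⟨n, rfl⟩
      exact ⟨Submodule.Quotient.mk n, hθbar n⟩
  have hfin' : Finite (↥(Submodule.torsionBy S N₂ r).toAddSubgroup ⧸
      (θbar.range).addSubgroupOf (Submodule.torsionBy S N₂ r).toAddSubgroup) := by
    rw [hrange]; exact hfin
  -- `(N₁ ⧸ K)^∨ ↪ N₁^∨` is finitely generated (Noetherian `R`)
  haveI : Module.Finite R (CharacterModule (N₁ ⧸ K)) :=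
    Module.Finite.of_injective (CharacterModule.dual K.mkQ)
      (CharacterModule.dual_injective_of_surjective _ (Submodule.mkQ_surjective K))
  exact Theorems.ErratumThm23TwoVariable.ControlDualFinite.module_finite_characterModule_of_finite_index
    C r θbar hθbarC hθbarr hinj hfin' htors

end FiniteGeneration

end Summit.BirchSwinnertonDyer.BirchSwinnertonDyer.Cruxes.BSDpOnCellC.ClassicalWitness

end
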